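import Summits.Ventures.PercRepro.Antipodal
import Summits.Ventures.PercRepro.Cross3

/-!
# The antipodal SMC principle, part A (p6, gen 3; split for the 400-line lint)

The polarised concavity `antipodalSum_insert_ge`, `antipodalSum_nonneg_of_second_difference`,
`antipodal_criterion_of_second_difference`, `sum_compl_nonneg_of_second_difference` (section `AntipodalSMC`).
The rest of the original file (the kernel lemmas, the classification of `Setoid (Fin 3)`, `LemmaB3Abstract_holds`,
`C004_holds_antipodal`, the `MultiGraph` corollaries) is `AntipodalSMC.lean`, which imports this file.
-/

namespace PercRepro

open Finset

section AntipodalSMC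

variable {E : Type*} [Fintype E] [DecidableEq E]

omit [Fintype E] in
/-- Forcing edges keeps a probability vector a probability vector. -/
theorem forceOn_isProb {p : E → ℝ} (hp : IsProb p) (S : Finset E) (σ : Config E) :
    IsProb (forceOn p S σ) := by
  intro e
  unfold forceOn
  split_ifs
  · norm_num
  · norm_num
  · exact hp e

/-- Reindexing a double sum with two weight vectors updated at one edge. -/
theorem dsum_weight_update_two (p q : E → ℝ) (e : E) (b b' : Bool)
    (F : Config E → Config E → ℝ) :
    dsum (weight (Function.update p e (if b then 1 else 0)))
        (weight (Function.update q e (if b' then 1 else 0))) F =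
      ∑ η, ∑ η', weight (Function.update p e 0) η * weight (Function.update q e 0) η' *
        F (Function.update η e b) (Function.update η' e b') := by
  unfold dsum
  have h1 : ∀ ω, (∑ ω', weight (Function.update p e (if b then 1 else 0)) ω *
      weight (Function.update q e (if b' then 1 else 0)) ω' * F ω ω') =
      weight (Function.update p e (if b then 1 else 0)) ω *
        ∑ η', weight (Function.update q e 0) η' * F ω (Function.update η' e b') := by
    intro ω
    rw [← sum_weight_update q e b' (fun ω' => F ω ω'), Finset.mul_sum]
    refine Finset.sum_congr rfl fun ω' _ => ?_
    ring
  simp only [h1]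
  rw [sum_weight_update p e b
    (fun ω => ∑ η', weight (Function.update q e 0) η' * F ω (Function.update η' e b'))]
  refine Finset.sum_congr rfl fun η _ => ?_
  rw [Finset.mul_sum]
  refine Finset.sum_congr rfl fun η' _ => ?_
  ring

/-- **Second difference with two weight vectors**: if the second difference of `F` along `e` is
pointwise `≤ 0`, then `S(q¹,q'¹) - S(q¹,q'⁰) - S(q⁰,q'¹) + S(q⁰,q'⁰) ≤ 0` for any two probability
vectors `q, q'` (`q^b = q[e:=b]`). -/
theorem dsum_second_difference_nonpos_two {p q : E → ℝ} (hp : IsProb p) (hq : IsProb q) (e : E)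
    (F : Config E → Config E → ℝ)
    (hF : ∀ η η' : Config E,
      F (Function.update η e true) (Function.update η' e true) -
          F (Function.update η e true) (Function.update η' e false) -
          F (Function.update η e false) (Function.update η' e true) +
          F (Function.update η e false) (Function.update η' e false) ≤ 0) :
    dsum (weight (Function.update p e 1)) (weight (Function.update q e 1)) F -
        dsum (weight (Function.update p e 1)) (weight (Function.update q e 0)) F -
        dsum (weight (Function.update p e 0)) (weight (Function.update q e 1)) F +
        dsum (weight (Function.update p e 0)) (weight (Function.update q e 0)) F ≤ 0 := by
  have h11 := dsum_weight_update_two p q e true true F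
  have h10 := dsum_weight_update_two p q e true false F
  have h01 := dsum_weight_update_two p q e false true F
  have h00 := dsum_weight_update_two p q e false false F
  simp only [Bool.false_eq_true, if_true, if_false] at h11 h10 h01 h00
  rw [h11, h10, h01, h00]
  simp only [← Finset.sum_sub_distrib, ← Finset.sum_add_distrib]
  have hw : ∀ η, 0 ≤ weight (Function.update p e 0) η :=
    fun η => weight_nonneg (hp.update e (by norm_num)) η
  have hw' : ∀ η, 0 ≤ weight (Function.update q e 0) η :=
    fun η => weight_nonneg (hq.update e (by norm_num)) η
  refine Finset.sum_nonpos fun η _ => Finset.sum_nonpos fun η' _ => ?_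
  have := mul_nonpos_of_nonneg_of_nonpos (mul_nonneg (hw η) (hw' η')) (hF η η')
  linarith

/-- `Φ_S(p[g:=x])` as a sum of double sums of the updated corner laws (`g ∉ S`). -/
theorem antipodalSum_update_eq (p : E → ℝ) {S : Finset E} {g : E} (hg : g ∉ S) (x : ℝ)
    (F : Config E → Config E → ℝ) :
    antipodalSum (Function.update p g x) S F = ∑ σ : Config E,
      dsum (weight (Function.update (forceOn p S σ) g x))
        (weight (Function.update (forceOn p S (flipOn S σ)) g x)) F := by
  unfold antipodalSum
  simp only [forceOn_update p hg]

/-- **The cross term**: `2 Φ_{S ∪ {g}}(p)` is the sum over `σ` of the two mixed double sums of the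
corner laws `p[S:=σ]`, `p[S:=σ̄]` with `g` open in one and closed in the other (`g ∉ S`). -/
theorem two_mul_antipodalSum_insert (p : E → ℝ) {S : Finset E} {g : E} (hg : g ∉ S)
    (F : Config E → Config E → ℝ) :
    2 * antipodalSum p (insert g S) F = ∑ σ : Config E,
      (dsum (weight (Function.update (forceOn p S σ) g 1))
          (weight (Function.update (forceOn p S (flipOn S σ)) g 0)) F +
        dsum (weight (Function.update (forceOn p S σ) g 0))
          (weight (Function.update (forceOn p S (flipOn S σ)) g 1)) F) := by
  have hcross : antipodalSum p (insert g S) F =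
      ∑ σ : Config E, (if σ g then
        dsum (weight (Function.update (forceOn p S σ) g 1))
          (weight (Function.update (forceOn p S (flipOn S σ)) g 0)) F
      else
        dsum (weight (Function.update (forceOn p S σ) g 0))
          (weight (Function.update (forceOn p S (flipOn S σ)) g 1)) F) := by
    unfold antipodalSum
    refine Finset.sum_congr rfl fun σ _ => ?_
    rw [forceOn_insert p hg, forceOn_insert p hg, flipOn_insert, forceOn_update_config p hg,
      Function.update_self]
    cases h : σ g <;> simp
  rw [hcross, Finset.sum_add_distrib]
  have hinvA : ∀ σ, (fun σ => dsum (weight (Function.update (forceOn p S σ) g 1))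
      (weight (Function.update (forceOn p S (flipOn S σ)) g 0)) F) (flipEdge g σ) =
      (fun σ => dsum (weight (Function.update (forceOn p S σ) g 1))
      (weight (Function.update (forceOn p S (flipOn S σ)) g 0)) F) σ := by
    intro σ
    simp only [flipEdge, forceOn_update_config p hg, flipOn_update hg]
  have hinvB : ∀ σ, (fun σ => dsum (weight (Function.update (forceOn p S σ) g 0))
      (weight (Function.update (forceOn p S (flipOn S σ)) g 1)) F) (flipEdge g σ) =
      (fun σ => dsum (weight (Function.update (forceOn p S σ) g 0))
      (weight (Function.update (forceOn p S (flipOn S σ)) g 1)) F) σ := by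
    intro σ
    simp only [flipEdge, forceOn_update_config p hg, flipOn_update hg]
  rw [sum_eq_two_mul_sum_of_flip_invariant g
      (fun σ => dsum (weight (Function.update (forceOn p S σ) g 1))
        (weight (Function.update (forceOn p S (flipOn S σ)) g 0)) F) hinvA,
    sum_eq_two_mul_sum_of_flip_invariant' g
      (fun σ => dsum (weight (Function.update (forceOn p S σ) g 0))
        (weight (Function.update (forceOn p S (flipOn S σ)) g 1)) F) hinvB,
    ← mul_add, ← Finset.sum_add_distrib]
  refine congrArg (2 * ·) (Finset.sum_congr rfl fun σ _ => ?_)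
  cases σ g <;> simp

/-- **Polarised concavity**: for an SMC kernel the antipodal recursion is a concave quadratic in
`p g`, i.e. `Φ_S(p[g:=1]) + Φ_S(p[g:=0]) ≤ 2 Φ_{S ∪ {g}}(p)` (`g ∉ S`). -/
theorem antipodalSum_insert_ge {p : E → ℝ} (hp : IsProb p) {S : Finset E} {g : E} (hg : g ∉ S)
    (F : Config E → Config E → ℝ)
    (hF : ∀ η η' : Config E,
      F (Function.update η g true) (Function.update η' g true) -
          F (Function.update η g true) (Function.update η' g false) -
          F (Function.update η g false) (Function.update η' g true) +
          F (Function.update η g false) (Function.update η' g false) ≤ 0) :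
    antipodalSum (Function.update p g 1) S F + antipodalSum (Function.update p g 0) S F ≤
      2 * antipodalSum p (insert g S) F := by
  rw [antipodalSum_update_eq p hg 1 F, antipodalSum_update_eq p hg 0 F,
    two_mul_antipodalSum_insert p hg F, ← Finset.sum_add_distrib]
  refine Finset.sum_le_sum fun σ _ => ?_
  have := dsum_second_difference_nonpos_two (forceOn_isProb hp S σ)
    (forceOn_isProb hp S (flipOn S σ)) g F hF
  linarith

/-- **The antipodal SMC principle**: a kernel with nonnegative diagonal and pointwise nonpositive
second differences along every edge has `Φ_S(p) ≥ 0` for every edge set `S` and every probability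
vector `p`. -/
theorem antipodalSum_nonneg_of_second_difference (F : Config E → Config E → ℝ)
    (hdiag : ∀ ω, 0 ≤ F ω ω)
    (hF : ∀ (e : E) (η η' : Config E),
      F (Function.update η e true) (Function.update η' e true) -
          F (Function.update η e true) (Function.update η' e false) -
          F (Function.update η e false) (Function.update η' e true) +
          F (Function.update η e false) (Function.update η' e false) ≤ 0)
    (S : Finset E) {p : E → ℝ} (hp : IsProb p) : 0 ≤ antipodalSum p S F := by
  induction S using Finset.induction_on generalizing p with
  | empty =>
    rw [antipodalSum_empty]
    exact mul_nonneg (Nat.cast_nonneg _) (dsum_nonneg_of_second_difference F hdiag hF hp)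
  | insert g S hg ih =>
    have h1 := ih (hp.update g (x := 1) ⟨by norm_num, by norm_num⟩)
    have h0 := ih (hp.update g (x := 0) ⟨by norm_num, by norm_num⟩)
    have h := antipodalSum_insert_ge hp hg F (hF g)
    linarith

/-- **p4's antipodal criterion is a theorem for SMC kernels**: over every sub-cube `S` of
configurations (the other edges fixed to `ω₀`) the kernel summed over antipodal pairs is
nonnegative. -/
theorem antipodal_criterion_of_second_difference (F : Config E → Config E → ℝ)
    (hdiag : ∀ ω, 0 ≤ F ω ω)
    (hF : ∀ (e : E) (η η' : Config E),
      F (Function.update η e true) (Function.update η' e true) -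
          F (Function.update η e true) (Function.update η' e false) -
          F (Function.update η e false) (Function.update η' e true) +
          F (Function.update η e false) (Function.update η' e false) ≤ 0)
    (S : Finset E) (ω₀ : Config E) :
    0 ≤ ∑ σ : Config E, F (patch S σ ω₀) (patch S (flipOn S σ) ω₀) := by
  have h := antipodalSum_nonneg_of_second_difference F hdiag hF S (isProb_detWeights ω₀)
  have hdet : ∀ e ∉ S, detWeights ω₀ e = 0 ∨ detWeights ω₀ e = 1 := by
    intro e _
    unfold detWeights
    split_ifs
    · exact Or.inr rfl
    · exact Or.inl rfl
  rw [antipodalSum_eq_of_det hdet] at h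
  have hω : (fun e => decide (detWeights ω₀ e = 1)) = ω₀ := by
    funext e
    unfold detWeights
    cases ω₀ e <;> simp
  rwa [hω] at h

/-- Patching every edge is the identity. -/
theorem patch_univ (σ ω₀ : Config E) : patch univ σ ω₀ = σ := by
  funext e
  simp [patch]

/-- Flipping every edge is the complement. -/
theorem flipOn_univ (σ : Config E) : flipOn univ σ = σᶜ := by
  funext e
  simp only [flipOn, Finset.mem_univ, if_true, Pi.compl_apply]
  rfl

/-- **The antipodal sum of an SMC kernel is nonnegative**: `Σ_σ F(σ, σᶜ) ≥ 0`. -/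
theorem sum_compl_nonneg_of_second_difference (F : Config E → Config E → ℝ)
    (hdiag : ∀ ω, 0 ≤ F ω ω)
    (hF : ∀ (e : E) (η η' : Config E),
      F (Function.update η e true) (Function.update η' e true) -
          F (Function.update η e true) (Function.update η' e false) -
          F (Function.update η e false) (Function.update η' e true) +
          F (Function.update η e false) (Function.update η' e false) ≤ 0) :
    0 ≤ ∑ σ : Config E, F σ σᶜ := by
  have h := antipodal_criterion_of_second_difference F hdiag hF univ (fun _ => false)
  simpa only [patch_univ, flipOn_univ] using h

end AntipodalSMC

end PercRepro
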